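import Summits.QuantumFields.YangMills.Theorems.BalabanUVNodesN19LawPriceJackson
import Summits.QuantumFields.YangMills.Theorems.BalabanUVNodesN19LawSummabilityThreshold

/-!
# YM-DAG node N19 (= NE7 proper) — POLYNOMIAL OBSERVABLES CONVERGE ABSOLUTELY UNDER N19's TARGET (geometric remainders); Lipschitz ones need not
# (the smooth half of the fixed-observable dichotomy; the Lipschitz half is module 83)

Cell `pub-ymgap`, HUMAN RULING D-0062 (Track A) ∕ D-0149 (work-bound push), R141 (C) wider-strategy seat `pub-ymgap-dag-n19-e` (strategy s3 =
ALTERNATIVE CURRENCY), generation g23, module 7 (lineage module 84).  Route `Summits/QuantumFields/YangMills/Theses/BalabanUVNodes.lean` rev 25,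
cluster item K3⁷ «SpineGivenEndpointR13SepCoPH» (stmt-QuantumFields-20544); filed `--supports` that item `--as helper` (it proves no registered
stub).  COUNT-NEUTRAL: [folklore] over Mathlib (`summable_pow_mul_geometric_of_norm_lt_one`, `Real.posLog`) + the lineage BY NAME — p554543
`…N19LawPriceJackson` (`abs_moment_sub_le_uniform_symm`: moments from window matching, all orders; `abs_integral_eval_sub_le`: a polynomial against `ν − μ`
costs its coefficient mass times the moment distance), module 74 `…N19LawSummabilityThreshold` (`cgf_increment_le_of_matchingModConstants`,
`vol_mul_delta_nonneg_of_matchingModConstants`); `MatchingModConstants` ∕ `Spine.NE7.Target` (N19's DECL-target SHAPE) are HYPOTHESES on TOY laws; no scheme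
object, no Theses import; NOT a discharge claim.

THE POINT.  Module 83: under `Spine.NE7.Target vol l₀ (Cθ^K)` there is ONE law sequence and ONE Lipschitz observable whose expectations converge but NOT
absolutely.  THIS FILE is the other half of the dichotomy: for POLYNOMIAL observables the increments are ALWAYS summable under window matching with
geometric (indeed any `Σ_K δ_K·(1 + log⁺(2vol·δ_K)⁻¹)^d < ∞`) remainders.  §1 ★ `polyIncrement_le_of_cgf_close`: laws `μ, ν` on `[−1,1]` with cgfs `ε`-close
on `|t| ≤ l₀` (`0 < l₀`, `0 ≤ ε`), `q` a polynomial of degree `≤ d`: `|∫q dν − ∫q dμ| ≤ Λ(q)·d!·2εe^{l₀}·A(ε)^d`, `Λ(q) = Σ_i |q_i|`,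
`A(ε) = max(1, 2e·max(1, log⁺ε⁻¹)∕l₀)` (p554543's two lemmas composed).  §2 ★★ `summable_polyIncrements_of_matchingModConstants`: probability laws `λ_K` on
`[−1,1]` with `MatchingModConstants vol l₀ δ (K t ↦ mgf λ_K t)` and `Σ_K vol·δ_K·A(2vol·δ_K)^d < ∞` ⇒ every polynomial of degree `≤ d` has summable increments
`|∫q dλ_{K+1} − ∫q dλ_K|`.  §3 ★★ `summable_polyIncrements_of_target_geometric`: under `Spine.NE7.Target vol l₀ (Cθ^K) (K t ↦ mgf λ_K t)` (`C > 0`,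
`0 < θ < 1`) EVERY polynomial observable has summable increments (`A(2vol·Cθ^K) ≤ c·(K+1)`, `Σ_K (K+1)^d θ^K < ∞`).  DICHOTOMY (with module 83): under N19's
Target at the programme's remainders, smooth (polynomial) observables converge absolutely, Lipschitz observables converge but not absolutely in general —
the gap between the linear-log price of the expectation currency (p481156) and the `log log∕log` price of the law currency (p555512), read along the tower.

HONEST FRAMING (binding).  Elementary and [folklore]; TOY laws; NO consumer in the DAG today (a structural statement about the seat's own currencies);
nothing of Bałaban's instantiated; NE7 NOT PRINTED, NOT proved; N19 NOT discharged; count-neutral.  One finite `T⁴` programme at fixed `ε`; nothing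
continuum ∕ `ℝ⁴` ∕ OS ∕ mass-gap ∕ Clay.  0 `def` ∕ 0 `sorry`.
-/

noncomputable section

open Real Finset MeasureTheory ProbabilityTheory Polynomial

namespace Summit.QuantumFields.YangMills.Theorems.BalabanUVNodesN19TargetPolynomialTestSummable

open Literature.MathematicalPhysics.QuantumFieldTheory.Balaban1983to89
open T4CauchySum (MatchingModConstants)
open Summit.QuantumFields.BalabanUV.T4Continuum.Spine
open Summit.QuantumFields.YangMills.Theorems.BalabanUVNodesN19LawPriceJackson (abs_moment_sub_le_uniform_symm abs_integral_eval_sub_le)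
open Summit.QuantumFields.YangMills.Theorems.BalabanUVNodesN19LawSummabilityThreshold
  (cgf_increment_le_of_matchingModConstants vol_mul_delta_nonneg_of_matchingModConstants)

/-! ## §1 One step: a polynomial against two window-close laws [folklore] -/

section Laws

variable {μ ν : Measure ℝ} [IsProbabilityMeasure μ] [IsProbabilityMeasure ν]

/-- ★ **A POLYNOMIAL OF DEGREE `≤ d` AGAINST TWO WINDOW-CLOSE LAWS.**  Laws `μ, ν` on `[−1,1]`, cgfs `ε`-close on `|t| ≤ l₀` (`0 < l₀`, `0 ≤ ε`), `q` with
`natDegree q ≤ d`: `|∫q dν − ∫q dμ| ≤ (Σ_{i≤d}|q_i|)·(d!·2εe^{l₀}·A^d)`, `A = max(1, 2e·max(1, log⁺ε⁻¹)∕l₀)` (p554543). [folklore] -/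
theorem polyIncrement_le_of_cgf_close (hμ : μ (Set.Icc (-1) 1)ᶜ = 0) (hν : ν (Set.Icc (-1) 1)ᶜ = 0) {ε l₀ : ℝ} (hl₀ : 0 < l₀) (hε0 : 0 ≤ ε)
    (hε : ∀ t : ℝ, |t| ≤ l₀ → |cgf id ν t - cgf id μ t| ≤ ε) {d : ℕ} {q : ℝ[X]} (hq : q.natDegree ≤ d) :
    |∫ x, q.eval x ∂ν - ∫ x, q.eval x ∂μ| ≤
      (∑ i ∈ range (d + 1), |q.coeff i|) * (d.factorial * (2 * ε * Real.exp l₀) * (max 1 (2 * Real.exp 1 * max 1 (Real.posLog ε⁻¹) / l₀)) ^ d) :=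
  abs_integral_eval_sub_le hμ hν (by positivity) (fun i hi1 hi => abs_moment_sub_le_uniform_symm hμ hν hl₀ hε0 hε hi1 hi) hq

end Laws

/-! ## §2 Along the tower under window matching modulo constants [folklore] -/

/-- ★★ **POLYNOMIAL OBSERVABLES HAVE SUMMABLE INCREMENTS UNDER WINDOW MATCHING** when `Σ_K vol·δ_K·A(2vol·δ_K)^d < ∞`.  Probability laws `λ_K` on `[−1,1]`
with `MatchingModConstants vol l₀ δ (K t ↦ mgf λ_K t)` (`0 < l₀`; consecutive cgfs are `2vol·δ_K`-close on the window, module 74) and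
`Summable (K ↦ vol·δ_K · A_K^d)` with `A_K = max(1, 2e·max(1, log⁺(2vol·δ_K)⁻¹)∕l₀)`: then for every polynomial `q` of degree `≤ d` the increments
`|∫q dλ_{K+1} − ∫q dλ_K|` are summable. [folklore] -/
theorem summable_polyIncrements_of_matchingModConstants {Λ : ℕ → Measure ℝ} [hP : ∀ K, IsProbabilityMeasure (Λ K)]
    (hΛ : ∀ K, Λ K (Set.Icc (-1 : ℝ) 1)ᶜ = 0) {vol l₀ : ℝ} (hl₀ : 0 < l₀) {δ : ℕ → ℝ}
    (hM : MatchingModConstants vol l₀ δ (fun K t => mgf id (Λ K) t)) {d : ℕ}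
    (hS : Summable fun K => vol * δ K * (max 1 (2 * Real.exp 1 * max 1 (Real.posLog (2 * (vol * δ K))⁻¹) / l₀)) ^ d)
    {q : ℝ[X]} (hq : q.natDegree ≤ d) :
    Summable fun K => |∫ x, q.eval x ∂Λ (K + 1) - ∫ x, q.eval x ∂Λ K| := by
  set Cq : ℝ := (∑ i ∈ range (d + 1), |q.coeff i|) * (d.factorial * (4 * Real.exp l₀)) with hCq
  refine Summable.of_nonneg_of_le (fun K => abs_nonneg _) (fun K => ?_) (hS.mul_left Cq)
  have hx : 0 ≤ vol * δ K := vol_mul_delta_nonneg_of_matchingModConstants hl₀.le hM K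
  have h := polyIncrement_le_of_cgf_close (hΛ K) (hΛ (K + 1)) hl₀ (by positivity : (0 : ℝ) ≤ 2 * (vol * δ K))
    (fun t ht => cgf_increment_le_of_matchingModConstants hl₀.le hM K t ht) hq
  refine h.trans (le_of_eq ?_)
  rw [hCq]
  ring

/-! ## §3 At the programme's geometric remainders, under `Target` [folklore] -/

/-- The growth of `A(2vol·Cθ^K)`: `max(1, 2e·max(1, log⁺(2volCθ^K)⁻¹)∕l₀) ≤ (1 + 2e∕l₀)·(1 + log⁺(2volC)⁻¹ + log⁺θ⁻¹)·(K+1)`. [folklore] -/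
theorem jacksonConstant_geometric_le {vol l₀ C θ : ℝ} (hl₀ : 0 < l₀) (K : ℕ) :
    max 1 (2 * Real.exp 1 * max 1 (Real.posLog (2 * (vol * (C * θ ^ K)))⁻¹) / l₀) ≤
      (1 + 2 * Real.exp 1 / l₀) * (1 + Real.posLog (2 * vol * C)⁻¹ + Real.posLog θ⁻¹) * ((K : ℝ) + 1) := by
  set a : ℝ := Real.posLog (2 * vol * C)⁻¹ with ha
  set bθ : ℝ := Real.posLog θ⁻¹ with hb
  have ha0 : 0 ≤ a := Real.posLog_nonneg
  have hb0 : 0 ≤ bθ := Real.posLog_nonneg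
  have hpl : Real.posLog (2 * (vol * (C * θ ^ K)))⁻¹ ≤ a + K * bθ := by
    rw [show 2 * (vol * (C * θ ^ K)) = (2 * vol * C) * θ ^ K by ring, mul_inv, ← inv_pow]
    calc Real.posLog ((2 * vol * C)⁻¹ * θ⁻¹ ^ K) ≤ Real.posLog (2 * vol * C)⁻¹ + Real.posLog (θ⁻¹ ^ K) := Real.posLog_mul
      _ = a + K * bθ := by rw [Real.posLog_pow]
  have hK0 : (0 : ℝ) ≤ K := Nat.cast_nonneg K
  have hmax : max 1 (Real.posLog (2 * (vol * (C * θ ^ K)))⁻¹) ≤ (1 + a + bθ) * ((K : ℝ) + 1) := by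
    refine max_le ?_ (hpl.trans ?_)
    · nlinarith
    · nlinarith [mul_nonneg ha0 hK0, mul_nonneg hb0 hK0]
  have he : 0 < 2 * Real.exp 1 / l₀ := by positivity
  refine max_le ?_ ?_
  · have h1 : (1 : ℝ) ≤ (1 + a + bθ) * ((K : ℝ) + 1) := by nlinarith
    nlinarith [mul_le_mul_of_nonneg_left h1 he.le]
  · rw [show 2 * Real.exp 1 * max 1 (Real.posLog (2 * (vol * (C * θ ^ K)))⁻¹) / l₀ =
        (2 * Real.exp 1 / l₀) * max 1 (Real.posLog (2 * (vol * (C * θ ^ K)))⁻¹) by ring]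
    have h2 := mul_le_mul_of_nonneg_left hmax he.le
    nlinarith [mul_nonneg (mul_nonneg (add_nonneg (add_nonneg zero_le_one ha0) hb0) (by linarith : (0 : ℝ) ≤ (K : ℝ) + 1)) zero_le_one]

/-- ★★ **UNDER N19's TARGET AT GEOMETRIC REMAINDERS EVERY POLYNOMIAL OBSERVABLE CONVERGES ABSOLUTELY.**  Probability laws `λ_K` on `[−1,1]` with
`Spine.NE7.Target vol l₀ (K ↦ Cθ^K) (K t ↦ mgf λ_K t)` (`0 < l₀`, `0 < vol`, `0 < C`, `0 < θ < 1`): for every polynomial `q`, the increments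
`|∫q dλ_{K+1} − ∫q dλ_K|` are summable (§2 at `d = natDegree q`; `A_K ≤ c(K+1)` and `Σ (K+1)^d θ^K < ∞`).  Contrast module 83: a Lipschitz
observable need not. [folklore] -/
theorem summable_polyIncrements_of_target_geometric {Λ : ℕ → Measure ℝ} [hP : ∀ K, IsProbabilityMeasure (Λ K)]
    (hΛ : ∀ K, Λ K (Set.Icc (-1 : ℝ) 1)ᶜ = 0) {vol l₀ C θ : ℝ} (hl₀ : 0 < l₀) (hvol : 0 < vol) (hC : 0 < C) (hθ0 : 0 < θ) (hθ1 : θ < 1)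
    (hT : NE7.Target vol l₀ (fun K => C * θ ^ K) (fun K t => mgf id (Λ K) t)) (q : ℝ[X]) :
    Summable fun K => |∫ x, q.eval x ∂Λ (K + 1) - ∫ x, q.eval x ∂Λ K| := by
  set d : ℕ := q.natDegree with hdd
  refine summable_polyIncrements_of_matchingModConstants hΛ hl₀ hT.1 (d := d) ?_ le_rfl
  -- domination by `vol·C·M^d · (K+1)^d θ^K`, `M = (1 + 2e∕l₀)(1 + log⁺(2volC)⁻¹ + log⁺θ⁻¹)`
  set M : ℝ := (1 + 2 * Real.exp 1 / l₀) * (1 + Real.posLog (2 * vol * C)⁻¹ + Real.posLog θ⁻¹) with hMdef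
  have hM0 : 0 ≤ M := by
    have := Real.posLog_nonneg (x := (2 * vol * C)⁻¹); have := Real.posLog_nonneg (x := θ⁻¹); positivity
  have hgeo : Summable fun K : ℕ => ((K : ℝ) + 1) ^ d * θ ^ K := by
    have h := summable_pow_mul_geometric_of_norm_lt_one d (show ‖θ‖ < 1 by rw [Real.norm_eq_abs, abs_of_pos hθ0]; exact hθ1)
    -- `(K+1)^d θ^K = θ⁻¹ · ((K+1)^d θ^{K+1})`, a shifted copy of `n^d θ^n`
    have h1 : Summable fun K : ℕ => (((K + 1 : ℕ) : ℝ)) ^ d * θ ^ (K + 1) := (summable_nat_add_iff 1).2 h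
    refine (h1.mul_left θ⁻¹).congr fun K => ?_
    push_cast
    rw [pow_succ]
    field_simp
  refine Summable.of_nonneg_of_le (fun K => by positivity) (fun K => ?_) (hgeo.mul_left (vol * C * M ^ d))
  have hA := jacksonConstant_geometric_le (vol := vol) (C := C) (θ := θ) hl₀ K
  have hA0 : 0 ≤ max 1 (2 * Real.exp 1 * max 1 (Real.posLog (2 * (vol * (C * θ ^ K)))⁻¹) / l₀) := le_trans zero_le_one (le_max_left _ _)
  calc vol * (C * θ ^ K) * (max 1 (2 * Real.exp 1 * max 1 (Real.posLog (2 * (vol * (C * θ ^ K)))⁻¹) / l₀)) ^ d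
      ≤ vol * (C * θ ^ K) * (M * ((K : ℝ) + 1)) ^ d := by
        refine mul_le_mul_of_nonneg_left (pow_le_pow_left₀ hA0 (by rw [hMdef]; exact hA) d) (by positivity)
    _ = vol * C * M ^ d * (((K : ℝ) + 1) ^ d * θ ^ K) := by rw [mul_pow]; ring

end Summit.QuantumFields.YangMills.Theorems.BalabanUVNodesN19TargetPolynomialTestSummable

end
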